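import Mathlib
import Literature.Probability.LatticeModels.TorusFourierProofs

/-!
# Route BalabanIR — crux 4R `BirGappedPhaseReductionR` (item `stmt-HubbardSuperconductivity-14846`):
# block-London coercivity VIII — counting lattice momenta in intervals and columns

Two bookkeeping lemmas for the Fermi-strip stiffness estimate (hypothesis (K1) of the kernel
symbol inequality):
* `card_latticePoints_Icc_ge`: the number of `j < L` with `2πj/L ∈ [α, β]` (`0 ≤ α`, `β < 2π`) is
  at least `(β - α)L/(2π) - 1`;
* `sum_torus_ge_of_columns`: a nonnegative function on `(ℤ/L)²` summed over the torus dominates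
  its sum over any "column family" `{(j₀, j₁) : j₁ ∈ J₁, j₀ ∈ J₀ j₁}` (`jᵢ < L`), hence
  `Σ_k g(k) ≥ Σ_{j₁ ∈ J₁} #J₀(j₁) · c` if `g ≥ c` on the family;
* `latticeMomentum_natCast`: the lattice momentum of `(j₀, j₁)` (`jᵢ < L`) is `(2πj₀/L, 2πj₁/L)`.
Elementary; no definition is introduced.
-/

noncomputable section

namespace Summit.HubbardSuperconductivity.HubbardSuperconductivity.Theorems

namespace BirBdG

open Finset Literature.Probability.LatticeModels

/-- **Lattice points in an interval**: for `0 ≤ α` and `β < 2π`,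
`#{j < L : α ≤ 2πj/L ≤ β} ≥ (β - α) L/(2π) - 1`. [folklore] -/
theorem card_latticePoints_Icc_ge (L : ℕ) [NeZero L] {α β : ℝ} (hα : 0 ≤ α) (hβ : β < 2 * Real.pi) :
    (β - α) * L / (2 * Real.pi) - 1 ≤
      (((Finset.range L).filter (fun j : ℕ =>
        α ≤ 2 * Real.pi * j / L ∧ 2 * Real.pi * j / L ≤ β)).card : ℝ) := by
  have hπ := Real.pi_pos
  have hL : (0 : ℝ) < L := by exact_mod_cast Nat.pos_of_ne_zero (NeZero.ne L)
  rcases lt_or_ge β α with hβα | hαβ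
  · have : (β - α) * L / (2 * Real.pi) ≤ 0 :=
      div_nonpos_of_nonpos_of_nonneg (mul_nonpos_of_nonpos_of_nonneg (by linarith) hL.le) (by positivity)
    linarith [Nat.cast_nonneg (α := ℝ) (((Finset.range L).filter (fun j : ℕ =>
        α ≤ 2 * Real.pi * j / L ∧ 2 * Real.pi * j / L ≤ β)).card)]
  set a : ℕ := ⌈α * L / (2 * Real.pi)⌉₊ with ha
  set c : ℕ := ⌊β * L / (2 * Real.pi)⌋₊ with hc
  have hβL : 0 ≤ β * L / (2 * Real.pi) :=
    div_nonneg (mul_nonneg (hα.trans hαβ) hL.le) (by positivity)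
  have hαL : 0 ≤ α * L / (2 * Real.pi) := div_nonneg (mul_nonneg hα hL.le) (by positivity)
  have hsub : Finset.Icc a c ⊆ (Finset.range L).filter (fun j : ℕ =>
      α ≤ 2 * Real.pi * j / L ∧ 2 * Real.pi * j / L ≤ β) := by
    intro j hj
    rw [Finset.mem_Icc] at hj
    have hj1 : α * L / (2 * Real.pi) ≤ j := le_trans (Nat.le_ceil _) (by exact_mod_cast hj.1)
    have hj2 : (j : ℝ) ≤ β * L / (2 * Real.pi) := le_trans (by exact_mod_cast hj.2) (Nat.floor_le hβL)
    rw [Finset.mem_filter, Finset.mem_range]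
    refine ⟨?_, ?_, ?_⟩
    · have : (j : ℝ) < L := by
        calc (j : ℝ) ≤ β * L / (2 * Real.pi) := hj2
          _ < 2 * Real.pi * L / (2 * Real.pi) := by gcongr
          _ = L := by field_simp
      exact_mod_cast this
    · rw [div_le_iff₀ (by positivity)] at hj1
      rw [le_div_iff₀ hL]
      linarith
    · rw [le_div_iff₀ (by positivity)] at hj2
      rw [div_le_iff₀ hL]
      linarith
  have hcard := Finset.card_le_card hsub
  rw [Nat.card_Icc] at hcard
  have h1 : ((c + 1 - a : ℕ) : ℝ) ≤ (((Finset.range L).filter (fun j : ℕ =>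
      α ≤ 2 * Real.pi * j / L ∧ 2 * Real.pi * j / L ≤ β)).card : ℝ) := by exact_mod_cast hcard
  have h2 : ((c : ℝ) + 1) - a ≤ ((c + 1 - a : ℕ) : ℝ) := by
    -- truncated subtraction dominates real subtraction (cf. `real_sub_le_natSub`)
    rcases le_or_gt a (c + 1) with h | h
    · rw [Nat.cast_sub h]; push_cast; exact le_rfl
    · rw [Nat.sub_eq_zero_of_le h.le, Nat.cast_zero]
      have : ((c : ℝ) + 1) < a := by exact_mod_cast h
      linarith
  have hcge : β * L / (2 * Real.pi) - 1 < c := Nat.sub_one_lt_floor _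
  have hale : (a : ℝ) < α * L / (2 * Real.pi) + 1 := Nat.ceil_lt_add_one hαL
  have : (β - α) * L / (2 * Real.pi) = β * L / (2 * Real.pi) - α * L / (2 * Real.pi) := by ring
  rw [this]
  linarith

variable {L : ℕ} [NeZero L]

omit [NeZero L] in
/-- The lattice momentum of the point with natural coordinates `j₀, j₁ < L`. [folklore] -/
theorem latticeMomentum_natCast : ∀ {L j₀ j₁ : ℕ}, j₀ < L → j₁ < L → Literature.Probability.LatticeModels.latticeMomentum L (![((j₀ : ℕ) : ZMod L), ((j₁ : ℕ) : ZMod L)] : Literature.Probability.LatticeModels.TorusSite 2 L) = ![2 * Real.pi * j₀ / L, 2 * Real.pi * j₁ / L] := by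
  intro L j₀ j₁ h₀ h₁
  funext i
  fin_cases i
  · simp [latticeMomentum, ZMod.val_natCast, Nat.mod_eq_of_lt h₀]
  · simp [latticeMomentum, ZMod.val_natCast, Nat.mod_eq_of_lt h₁]

/-- **A torus sum dominates its column families.** For `g ≥ 0` on `(ℤ/L)²`, a set of columns
`J₁ ⊆ {0,…,L-1}`, rows `J₀ j₁ ⊆ {0,…,L-1}` and a constant `c` with `c ≤ g(j₀, j₁)` on the family:
`Σ_{j₁ ∈ J₁} #J₀(j₁) · c ≤ Σ_k g k`. [folklore] -/
theorem sum_torus_ge_of_columns (g : TorusSite 2 L → ℝ) (hg : ∀ k, 0 ≤ g k)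
    (J₁ : Finset ℕ) (hJ₁ : ∀ j ∈ J₁, j < L) (J₀ : ℕ → Finset ℕ)
    (hJ₀ : ∀ j₁ ∈ J₁, ∀ j₀ ∈ J₀ j₁, j₀ < L) (c : ℝ)
    (hc : ∀ j₁ ∈ J₁, ∀ j₀ ∈ J₀ j₁, c ≤ g ![((j₀ : ℕ) : ZMod L), ((j₁ : ℕ) : ZMod L)]) :
    ∑ j₁ ∈ J₁, ((J₀ j₁).card : ℝ) * c ≤ ∑ k : TorusSite 2 L, g k := by
  classical
  set φ : (Σ _ : ℕ, ℕ) → TorusSite 2 L := fun s => ![((s.2 : ℕ) : ZMod L), ((s.1 : ℕ) : ZMod L)] with hφ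
  set Fam : Finset (Σ _ : ℕ, ℕ) := J₁.sigma J₀ with hFam
  have hinj : Set.InjOn φ (Fam : Set (Σ _ : ℕ, ℕ)) := by
    rintro ⟨j₁, j₀⟩ hs ⟨j₁', j₀'⟩ hs' heq
    rw [Finset.mem_coe, hFam, Finset.mem_sigma] at hs hs'
    have e0 := congrFun heq 0
    have e1 := congrFun heq 1
    simp only [hφ, Matrix.cons_val_zero, Matrix.cons_val_one, Matrix.cons_val_fin_one] at e0 e1
    have h0 : j₀ = j₀' := by
      have := congrArg ZMod.val e0
      rwa [ZMod.val_natCast, ZMod.val_natCast, Nat.mod_eq_of_lt (hJ₀ _ hs.1 _ hs.2),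
        Nat.mod_eq_of_lt (hJ₀ _ hs'.1 _ hs'.2)] at this
    have h1 : j₁ = j₁' := by
      have := congrArg ZMod.val e1
      rwa [ZMod.val_natCast, ZMod.val_natCast, Nat.mod_eq_of_lt (hJ₁ _ hs.1),
        Nat.mod_eq_of_lt (hJ₁ _ hs'.1)] at this
    subst h0; subst h1; rfl
  calc ∑ j₁ ∈ J₁, ((J₀ j₁).card : ℝ) * c = ∑ j₁ ∈ J₁, ∑ _j₀ ∈ J₀ j₁, c := by
        refine Finset.sum_congr rfl fun j₁ _ => ?_
        rw [Finset.sum_const, nsmul_eq_mul]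
    _ ≤ ∑ j₁ ∈ J₁, ∑ j₀ ∈ J₀ j₁, g ![((j₀ : ℕ) : ZMod L), ((j₁ : ℕ) : ZMod L)] :=
        Finset.sum_le_sum fun j₁ hj₁ => Finset.sum_le_sum fun j₀ hj₀ => hc j₁ hj₁ j₀ hj₀
    _ = ∑ s ∈ Fam, g (φ s) := by rw [hFam, Finset.sum_sigma]
    _ = ∑ k ∈ Fam.image φ, g k := (Finset.sum_image hinj).symm
    _ ≤ ∑ k : TorusSite 2 L, g k :=
        Finset.sum_le_univ_sum_of_nonneg fun k => hg k

end BirBdG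

end Summit.HubbardSuperconductivity.HubbardSuperconductivity.Theorems

end
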